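import Summits.ValiantsHypothesis.ValiantsHypothesis.Theorems.LacunarySymmetroidMatrixDescartesDoorA26WallBubblingTripleZero
import Summits.ValiantsHypothesis.ValiantsHypothesis.Theorems.LacunarySymmetroidMatrixDescartesDoorA26WallBubblingTowers

/-!
# `DoorA26` / line `wall_bubbling` — THE TRIPLE-ZERO LIFT FROM DERIVATIVE DATA (mean-value ladder for exponential sums)

HONEST FRAMING.  Object-search cell `pub-symmetroid`, crux `Theses.LacunarySymmetroid.DoorA26` (stmt-ValiantsHypothesis-19979; OPEN, typed,
never asserted).  W2 seat val-sym-door-p1 g18, file #50; def-free helper for obligation (R) of `Cruxes/DoorA26/Lines/wall_bubbling.lean`, completing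
#49 `…WallBubblingTripleZero` (`mem_twentyLocus_of_tripleZero`: a triple zero of `det P` unfolds into three simple zeros under the Q-shift, GIVEN
explicit cubic Taylor bounds at the triple zero).  Here the bounds are DERIVED from derivative data, so the lift becomes unconditional.

WHAT IS HERE.  §1 `abs_le_mul_pow_succ_of_deriv` — one rung of the MEAN-VALUE LADDER (`h(c) = 0`, `|h′(y)| ≤ L|y − c|^k` near `c` ⇒ `|h(x)| ≤ L|x − c|^{k+1}`,
from Mathlib's `Convex.norm_image_sub_le_of_norm_hasDerivWithin_le` on `[[c, x]]`).  §2 exponential sums `expSum a x` (the line's `Bubbling.expSum`):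
`abs_expSum_le` (crude bound on `|s| ≤ ρ`), `abs_expSum_sub_cubic_le` (`u(0) = u′(0) = u″(0) = 0`, `u‴(0) = 6A` as weighted sums ⇒
`|u(s) − A s³| ≤ (Σ|a_i x_i⁴| e^{|x_i|ρ}) s⁴` — four rungs), `abs_expSum_sub_linear_le` (two rungs), `expSum_add` (time shift), `iteratedDeriv_expSum_apply`
(values of the derivative tower, from the tree's `iteratedDeriv_expSum`), `det_expPencil_eq_expSum_fun` (function form of `Census.RealExp.det_expPencil_eq_expSum`),
`expSum_sub_sub`, `expPencil_add`.  §3 ★ `mem_twentyLocus_of_tripleZero_deriv`: the hypotheses of #49 at `t⋆` replaced by `det P(t⋆) = (det P)′(t⋆) =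
(det P)″(t⋆) = 0`, `(det P)‴(t⋆) = 6a` (as `deriv`/`iteratedDeriv`), `polar(P,Q)(t⋆) = 0`, `polar(P,Q)′(t⋆) = b`, `a κ_{j⋆} < 0`, `a b < 0` ⇒ `δ ∈ TwentyLocus`
(internally `ρ = 1`, `λ = −2a/b`, `M` = the sum of the three ladder constants of `det P`, `polar`, `det Q` written as exponential sums over
`Perm(Fin 2) × (Fin 2 → Fin 6)`).  READING for (R): the single-cluster multiplicity residual after #46–#50 = balance-type coincidences (≥ 7 touches) and zeros of
order ≥ 4 (same ladder, more rungs; not typed).  Nothing here bears on `DoorA26`, `DoorA34`, (W)/(M)/(R), `MatrixDescartes` (18050) or `VP ≠ VNP`;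
registers unchanged.

[folklore] mean value inequality; Taylor estimates for exponential sums; [this work] the packaging.
-/

-- `Summit.ValiantsHypothesis.ValiantsHypothesis.…` repeats a component by the D-0017 layout
-- (single-conjunct summit), which the `dupNamespace` linter flags; the name is mandated.
set_option linter.dupNamespace false

namespace Summit.ValiantsHypothesis.ValiantsHypothesis.Theorems.LacunarySymmetroidMatrixDescartes.WallBubbling

open Finset Filter Topology
open Bubbling (TwentyLocus expSum)

/-! ## §1 The mean-value ladder -/

/-- **One rung of the mean-value ladder.**  If `h` has derivative `h'` everywhere, `h c = 0`, and `|h' y| ≤ L |y − c|^k` for `|y − c| ≤ ρ`, then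
`|h x| ≤ L |x − c|^(k+1)` for `|x − c| ≤ ρ`. [folklore] -/
theorem abs_le_mul_pow_succ_of_deriv {h h' : ℝ → ℝ} {c L ρ : ℝ} {k : ℕ} (hd : ∀ y, HasDerivAt h (h' y) y) (hc : h c = 0)
    (hL : 0 ≤ L) (hb : ∀ y, |y - c| ≤ ρ → |h' y| ≤ L * |y - c| ^ k) :
    ∀ x, |x - c| ≤ ρ → |h x| ≤ L * |x - c| ^ (k + 1) := by
  intro x hx
  have hseg : ∀ y ∈ Set.uIcc c x, |y - c| ≤ |x - c| := fun y hy => Set.abs_sub_left_of_mem_uIcc hy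
  have hbound : ∀ y ∈ Set.uIcc c x, ‖h' y‖ ≤ L * |x - c| ^ k := by
    intro y hy
    rw [Real.norm_eq_abs]
    calc |h' y| ≤ L * |y - c| ^ k := hb y ((hseg y hy).trans hx)
      _ ≤ L * |x - c| ^ k := by
          apply mul_le_mul_of_nonneg_left _ hL
          exact pow_le_pow_left₀ (abs_nonneg _) (hseg y hy) k
  have hmv := Convex.norm_image_sub_le_of_norm_hasDerivWithin_le (s := Set.uIcc c x)
    (fun y _ => (hd y).hasDerivWithinAt) hbound (convex_uIcc c x) Set.left_mem_uIcc Set.right_mem_uIcc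
  rw [hc, sub_zero, Real.norm_eq_abs, Real.norm_eq_abs] at hmv
  calc |h x| ≤ L * |x - c| ^ k * |x - c| := hmv
    _ = L * |x - c| ^ (k + 1) := by ring

/-! ## §2 Exponential sums: towers, bounds, Taylor estimates at a point -/

/-- Crude bound for an exponential sum on `|s| ≤ ρ`: `|Σ a_i e^{x_i s}| ≤ Σ |a_i| e^{|x_i| ρ}`. [folklore] -/
theorem abs_expSum_le {ι : Type*} [Fintype ι] (a x : ι → ℝ) {ρ s : ℝ} (hs : |s| ≤ ρ) :
    |expSum a x s| ≤ ∑ i, |a i| * Real.exp (|x i| * ρ) := by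
  unfold Bubbling.expSum
  refine (Finset.abs_sum_le_sum_abs _ _).trans (Finset.sum_le_sum fun i _ => ?_)
  rw [abs_mul, Real.abs_exp]
  refine mul_le_mul_of_nonneg_left (Real.exp_le_exp.2 ?_) (abs_nonneg _)
  calc x i * s ≤ |x i * s| := le_abs_self _
    _ = |x i| * |s| := abs_mul _ _
    _ ≤ |x i| * ρ := mul_le_mul_of_nonneg_left hs (abs_nonneg _)

/-- **Cubic Taylor estimate for an exponential sum at `0`.**  If `u = Σ a_i e^{x_i s}` has `u(0) = u'(0) = u''(0) = 0` and `u'''(0) = 6a` (derivatives as the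
weighted sums `Σ a_i x_i^j`), then `|u(s) − a s³| ≤ M s⁴` for `|s| ≤ ρ` with `M = Σ |a_i| x_i⁴ e^{|x_i| ρ}` (mean-value ladder, four rungs). [folklore] -/
theorem abs_expSum_sub_cubic_le {ι : Type*} [Fintype ι] (a x : ι → ℝ) {A ρ : ℝ}
    (h0 : ∑ i, a i = 0) (h1 : ∑ i, a i * x i = 0) (h2 : ∑ i, a i * x i ^ 2 = 0) (h3 : ∑ i, a i * x i ^ 3 = 6 * A) :
    ∀ s, |s| ≤ ρ → |expSum a x s - A * s ^ 3| ≤ (∑ i, |a i * x i ^ 4| * Real.exp (|x i| * ρ)) * s ^ 4 := by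
  set M : ℝ := ∑ i, |a i * x i ^ 4| * Real.exp (|x i| * ρ) with hM
  have hM0 : 0 ≤ M := Finset.sum_nonneg fun i _ => by positivity
  -- the tower `U_j = Σ a_i x_i^j e^{x_i s}`
  let U : ℕ → ℝ → ℝ := fun j => expSum (fun i => a i * x i ^ j) x
  have hU : ∀ j s, HasDerivAt (U j) (U (j + 1) s) s := by
    intro j s
    have := Bubbling.hasDerivAt_expSum (fun i => a i * x i ^ j) x s
    simp only [mul_assoc, ← pow_succ] at this
    exact this
  have hU0 : ∀ j, U j 0 = ∑ i, a i * x i ^ j := fun j => by simp [U, Bubbling.expSum]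
  -- the corrected tower and its derivatives
  have d0 : ∀ s, HasDerivAt (fun s => U 0 s - A * s ^ 3) (U 1 s - 3 * A * s ^ 2) s := fun s =>
    ((hU 0 s).sub ((hasDerivAt_pow 3 s).const_mul A)).congr_deriv (by push_cast; ring)
  have d1 : ∀ s, HasDerivAt (fun s => U 1 s - 3 * A * s ^ 2) (U 2 s - 6 * A * s) s := fun s =>
    ((hU 1 s).sub ((hasDerivAt_pow 2 s).const_mul (3 * A))).congr_deriv (by push_cast; ring)
  have d2 : ∀ s, HasDerivAt (fun s => U 2 s - 6 * A * s) (U 3 s - 6 * A) s := fun s =>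
    ((hU 2 s).sub ((hasDerivAt_id s).const_mul (6 * A))).congr_deriv (by simp)
  have d3 : ∀ s, HasDerivAt (fun s => U 3 s - 6 * A) (U 4 s) s := fun s =>
    ((hU 3 s).sub (hasDerivAt_const s (6 * A))).congr_deriv (by simp)
  -- the top rung: |U 4 s| ≤ M for |s| ≤ ρ
  have b4 : ∀ y, |y - 0| ≤ ρ → |U 4 y| ≤ M * |y - 0| ^ 0 := by
    intro y hy
    rw [sub_zero] at hy
    rw [pow_zero, mul_one]
    have := abs_expSum_le (fun i => a i * x i ^ 4) x hy
    simpa [U, hM] using this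
  have b3 := abs_le_mul_pow_succ_of_deriv d3 (by simp [hU0, h3]) hM0 b4
  have b2 := abs_le_mul_pow_succ_of_deriv d2 (by simp [hU0, h2]) hM0 b3
  have b1 := abs_le_mul_pow_succ_of_deriv d1 (by simp [hU0, h1]) hM0 b2
  have b0 := abs_le_mul_pow_succ_of_deriv d0 (by simp [hU0, h0]) hM0 b1
  intro s hs
  have h := b0 s (by simpa using hs)
  have h4 : |s - 0| ^ (0 + 1 + 1 + 1 + 1) = s ^ 4 := by
    rw [sub_zero, show 0 + 1 + 1 + 1 + 1 = 4 from rfl, ← abs_pow]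
    exact abs_of_nonneg (by positivity)
  rw [h4] at h
  simpa [U] using h

/-- **Linear Taylor estimate for an exponential sum at `0`**: `u(0) = 0`, `u'(0) = b` ⇒ `|u(s) − b s| ≤ (Σ |a_i x_i²| e^{|x_i| ρ}) s²` for `|s| ≤ ρ`. [folklore] -/
theorem abs_expSum_sub_linear_le {ι : Type*} [Fintype ι] (a x : ι → ℝ) {B ρ : ℝ}
    (h0 : ∑ i, a i = 0) (h1 : ∑ i, a i * x i = B) :
    ∀ s, |s| ≤ ρ → |expSum a x s - B * s| ≤ (∑ i, |a i * x i ^ 2| * Real.exp (|x i| * ρ)) * s ^ 2 := by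
  set M : ℝ := ∑ i, |a i * x i ^ 2| * Real.exp (|x i| * ρ) with hM
  have hM0 : 0 ≤ M := Finset.sum_nonneg fun i _ => by positivity
  let U : ℕ → ℝ → ℝ := fun j => expSum (fun i => a i * x i ^ j) x
  have hU : ∀ j s, HasDerivAt (U j) (U (j + 1) s) s := by
    intro j s
    have := Bubbling.hasDerivAt_expSum (fun i => a i * x i ^ j) x s
    simp only [mul_assoc, ← pow_succ] at this
    exact this
  have hU0 : ∀ j, U j 0 = ∑ i, a i * x i ^ j := fun j => by simp [U, Bubbling.expSum]
  have d0 : ∀ s, HasDerivAt (fun s => U 0 s - B * s) (U 1 s - B) s := fun s =>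
    ((hU 0 s).sub ((hasDerivAt_id s).const_mul B)).congr_deriv (by simp)
  have d1 : ∀ s, HasDerivAt (fun s => U 1 s - B) (U 2 s) s := fun s =>
    ((hU 1 s).sub (hasDerivAt_const s B)).congr_deriv (by simp)
  have b2 : ∀ y, |y - 0| ≤ ρ → |U 2 y| ≤ M * |y - 0| ^ 0 := by
    intro y hy
    rw [sub_zero] at hy
    rw [pow_zero, mul_one]
    have := abs_expSum_le (fun i => a i * x i ^ 2) x hy
    simpa [U, hM] using this
  have b1 := abs_le_mul_pow_succ_of_deriv d1 (by simp [hU0, h1]) hM0 b2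
  have b0 := abs_le_mul_pow_succ_of_deriv d0 (by simp [hU0, h0]) hM0 b1
  intro s hs
  have h := b0 s (by simpa using hs)
  have h2 : |s - 0| ^ (0 + 1 + 1) = s ^ 2 := by
    rw [sub_zero, show 0 + 1 + 1 = 2 from rfl, ← abs_pow]
    exact abs_of_nonneg (by positivity)
  rw [h2] at h
  simpa [U] using h


/-- Shifting the time in an exponential sum multiplies the coefficients. [folklore] -/
theorem expSum_add {ι : Type*} [Fintype ι] (a x : ι → ℝ) (c s : ℝ) :
    expSum a x (c + s) = expSum (fun i => a i * Real.exp (x i * c)) x s := by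
  unfold Bubbling.expSum
  refine Finset.sum_congr rfl fun i _ => ?_
  rw [mul_add, Real.exp_add]; ring

/-- The value of the `j`-th derivative of an exponential sum at a point. [folklore] -/
theorem iteratedDeriv_expSum_apply {ι : Type*} [Fintype ι] (a x : ι → ℝ) (j : ℕ) (c : ℝ) :
    iteratedDeriv j (expSum a x) c = ∑ i, (a i * Real.exp (x i * c)) * x i ^ j := by
  rw [iteratedDeriv_expSum]
  unfold Bubbling.expSum
  refine Finset.sum_congr rfl fun i _ => ?_
  ring

/-- The determinant of an exponential pencil of `2 × 2` letters as an exponential sum (function form of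
`Census.RealExp.det_expPencil_eq_expSum`). [folklore] -/
theorem det_expPencil_eq_expSum_fun (δ : Fin 6 → ℝ) (S : Fin 6 → Matrix (Fin 2) (Fin 2) ℝ) :
    (fun t => (∑ l, Real.exp (δ l * t) • S l).det)
      = expSum (fun p : Equiv.Perm (Fin 2) × (Fin 2 → Fin 6) => ((Equiv.Perm.sign p.1 : ℤ) : ℝ) * ∏ i, S (p.2 i) (p.1 i) i)
          (fun p => ∑ i, δ (p.2 i)) := by
  funext t
  rw [Census.RealExp.det_expPencil_eq_expSum]
  rfl



/-- Exponential sums are linear in the coefficients. [folklore] -/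
theorem expSum_sub_sub {ι : Type*} [Fintype ι] (a a' a'' x : ι → ℝ) (t : ℝ) :
    expSum a x t - expSum a' x t - expSum a'' x t = expSum (fun i => a i - a' i - a'' i) x t := by
  unfold Bubbling.expSum
  rw [← Finset.sum_sub_distrib, ← Finset.sum_sub_distrib]
  refine Finset.sum_congr rfl fun i _ => ?_
  ring

/-- The pencil of the summed letters. [folklore] -/
theorem expPencil_add (δ : Fin 6 → ℝ) (S T : Fin 6 → Matrix (Fin 2) (Fin 2) ℝ) (t : ℝ) :
    (∑ l, Real.exp (δ l * t) • S l) + (∑ l, Real.exp (δ l * t) • T l) = ∑ l, Real.exp (δ l * t) • (S l + T l) := by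
  rw [← Finset.sum_add_distrib]
  refine Finset.sum_congr rfl fun l _ => ?_
  rw [smul_add]

/-! ## §3 The triple-zero lift from derivative data -/

/-- **THE TRIPLE-ZERO LIFT FROM DERIVATIVE DATA (unconditional form of #49).**  As in `mem_twentyLocus_of_tripleZero`, but the cubic Taylor bounds are
DERIVED: the hypotheses at `t⋆` are `det P(t⋆) = (det P)′(t⋆) = (det P)″(t⋆) = 0`, `(det P)‴(t⋆) = 6a`, `polar(P,Q)(t⋆) = 0`, `polar(P,Q)′(t⋆) = b`
with `a κ_{j⋆} < 0` and `a b < 0` (the shift tilts the cubic against its leading sign; internally `λ = −2a/b`, `ρ = 1`, and the Taylor constants come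
from the mean-value ladder for the three exponential sums `det P`, `polar`, `det Q`). [this work] -/
theorem mem_twentyLocus_of_tripleZero_deriv (δ : Fin 6 → ℝ) (S T : Fin 6 → Matrix (Fin 2) (Fin 2) ℝ)
    (hS : ∀ l, (S l).IsSymm) (hT : ∀ l, (T l).IsSymm) (τ : Fin 19 → ℝ) (hτ : StrictMono τ) (κ : Fin 19 → ℝ)
    (hκ : ∀ j, 0 < κ j * (∑ l, Real.exp (δ l * τ j) • S l).det ∨
      ((∑ l, Real.exp (δ l * τ j) • S l).det = 0 ∧
        0 < κ j * (((∑ l, Real.exp (δ l * τ j) • S l) + (∑ l, Real.exp (δ l * τ j) • T l)).det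
              - (∑ l, Real.exp (δ l * τ j) • S l).det - (∑ l, Real.exp (δ l * τ j) • T l).det)) ∨
      ((∑ l, Real.exp (δ l * τ j) • S l).det = 0 ∧
        ((∑ l, Real.exp (δ l * τ j) • S l) + (∑ l, Real.exp (δ l * τ j) • T l)).det
              - (∑ l, Real.exp (δ l * τ j) • S l).det - (∑ l, Real.exp (δ l * τ j) • T l).det = 0 ∧
        0 < κ j * (∑ l, Real.exp (δ l * τ j) • T l).det))
    (halt : ∀ j : Fin 18, κ j.castSucc * κ j.succ < 0)
    (jstar : Fin 18) (tstar a b : ℝ) (ht1 : τ jstar.castSucc < tstar) (ht2 : tstar < τ jstar.succ)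
    (haκ : a * κ jstar.castSucc < 0) (hab : a * b < 0)
    (hD0 : (∑ l, Real.exp (δ l * tstar) • S l).det = 0)
    (hD1 : deriv (fun t => (∑ l, Real.exp (δ l * t) • S l).det) tstar = 0)
    (hD2 : iteratedDeriv 2 (fun t => (∑ l, Real.exp (δ l * t) • S l).det) tstar = 0)
    (hD3 : iteratedDeriv 3 (fun t => (∑ l, Real.exp (δ l * t) • S l).det) tstar = 6 * a)
    (hB0 : ((∑ l, Real.exp (δ l * tstar) • S l) + (∑ l, Real.exp (δ l * tstar) • T l)).det
              - (∑ l, Real.exp (δ l * tstar) • S l).det - (∑ l, Real.exp (δ l * tstar) • T l).det = 0)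
    (hB1 : deriv (fun t => ((∑ l, Real.exp (δ l * t) • S l) + (∑ l, Real.exp (δ l * t) • T l)).det
              - (∑ l, Real.exp (δ l * t) • S l).det - (∑ l, Real.exp (δ l * t) • T l).det) tstar = b) :
    δ ∈ TwentyLocus := by
  classical
  -- the three exponential sums (common exponent family `x`)
  let ι := Equiv.Perm (Fin 2) × (Fin 2 → Fin 6)
  let x : ι → ℝ := fun p => ∑ i, δ (p.2 i)
  let aD : ι → ℝ := fun p => ((Equiv.Perm.sign p.1 : ℤ) : ℝ) * ∏ i, S (p.2 i) (p.1 i) i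
  let aQ : ι → ℝ := fun p => ((Equiv.Perm.sign p.1 : ℤ) : ℝ) * ∏ i, T (p.2 i) (p.1 i) i
  let aPQ : ι → ℝ := fun p => ((Equiv.Perm.sign p.1 : ℤ) : ℝ) * ∏ i, (S (p.2 i) + T (p.2 i)) (p.1 i) i
  have hDfun : (fun t => (∑ l, Real.exp (δ l * t) • S l).det) = expSum aD x := det_expPencil_eq_expSum_fun δ S
  have hQfun : (fun t => (∑ l, Real.exp (δ l * t) • T l).det) = expSum aQ x := det_expPencil_eq_expSum_fun δ T
  have hPQfun : (fun t => ((∑ l, Real.exp (δ l * t) • S l) + (∑ l, Real.exp (δ l * t) • T l)).det) = expSum aPQ x := by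
    have := det_expPencil_eq_expSum_fun δ (fun l => S l + T l)
    refine (funext fun t => ?_).trans this
    show ((∑ l, Real.exp (δ l * t) • S l) + (∑ l, Real.exp (δ l * t) • T l)).det = (∑ l, Real.exp (δ l * t) • (S l + T l)).det
    rw [expPencil_add]
  let aB : ι → ℝ := fun p => aPQ p - aD p - aQ p
  have hBfun : (fun t => ((∑ l, Real.exp (δ l * t) • S l) + (∑ l, Real.exp (δ l * t) • T l)).det
      - (∑ l, Real.exp (δ l * t) • S l).det - (∑ l, Real.exp (δ l * t) • T l).det) = expSum aB x := by
    funext t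
    have h1 := congrFun hPQfun t; have h2 := congrFun hDfun t; have h3 := congrFun hQfun t
    rw [h1, h2, h3, expSum_sub_sub]
  -- shifted coefficients
  let aD' : ι → ℝ := fun p => aD p * Real.exp (x p * tstar)
  let aB' : ι → ℝ := fun p => aB p * Real.exp (x p * tstar)
  let aQ' : ι → ℝ := fun p => aQ p * Real.exp (x p * tstar)
  -- derivative data as weighted sums
  have sD : ∀ j, iteratedDeriv j (fun t => (∑ l, Real.exp (δ l * t) • S l).det) tstar = ∑ p, aD' p * x p ^ j := by
    intro j; rw [hDfun, iteratedDeriv_expSum_apply]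
  have sB : ∀ j, iteratedDeriv j (fun t => ((∑ l, Real.exp (δ l * t) • S l) + (∑ l, Real.exp (δ l * t) • T l)).det
      - (∑ l, Real.exp (δ l * t) • S l).det - (∑ l, Real.exp (δ l * t) • T l).det) tstar = ∑ p, aB' p * x p ^ j := by
    intro j; rw [hBfun, iteratedDeriv_expSum_apply]
  have h0 : ∑ p, aD' p = 0 := by
    have := sD 0; simp only [iteratedDeriv_zero, pow_zero, mul_one] at this; rw [← this]; exact hD0
  have h1 : ∑ p, aD' p * x p = 0 := by
    have := sD 1; simp only [iteratedDeriv_one, pow_one] at this; rw [← this]; exact hD1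
  have h2 : ∑ p, aD' p * x p ^ 2 = 0 := by rw [← sD 2]; exact hD2
  have h3 : ∑ p, aD' p * x p ^ 3 = 6 * a := by rw [← sD 3]; exact hD3
  have g0 : ∑ p, aB' p = 0 := by
    have := sB 0; simp only [iteratedDeriv_zero, pow_zero, mul_one] at this; rw [← this]; exact hB0
  have g1 : ∑ p, aB' p * x p = b := by
    have := sB 1; simp only [iteratedDeriv_one, pow_one] at this; rw [← this]; exact hB1
  -- Taylor constants (ρ = 1)
  set MF : ℝ := ∑ p, |aD' p * x p ^ 4| * Real.exp (|x p| * 1) with hMF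
  set MG : ℝ := ∑ p, |aB' p * x p ^ 2| * Real.exp (|x p| * 1) with hMG
  set MH : ℝ := ∑ p, |aQ' p| * Real.exp (|x p| * 1) with hMH
  have hMF0 : 0 ≤ MF := Finset.sum_nonneg fun p _ => by positivity
  have hMG0 : 0 ≤ MG := Finset.sum_nonneg fun p _ => by positivity
  have hMH0 : 0 ≤ MH := Finset.sum_nonneg fun p _ => by positivity
  set M : ℝ := MF + MG + MH with hM
  have cF := abs_expSum_sub_cubic_le aD' x (A := a) (ρ := 1) h0 h1 h2 h3
  have cG := abs_expSum_sub_linear_le aB' x (B := b) (ρ := 1) g0 g1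
  -- the shifted functions are these exponential sums
  have eF : ∀ s, (∑ l, Real.exp (δ l * (tstar + s)) • S l).det = expSum aD' x s := by
    intro s; have := congrFun hDfun (tstar + s); rw [this, expSum_add]
  have eG : ∀ s, ((∑ l, Real.exp (δ l * (tstar + s)) • S l) + (∑ l, Real.exp (δ l * (tstar + s)) • T l)).det
      - (∑ l, Real.exp (δ l * (tstar + s)) • S l).det - (∑ l, Real.exp (δ l * (tstar + s)) • T l).det = expSum aB' x s := by
    intro s; have := congrFun hBfun (tstar + s); rw [this, expSum_add]
  have eH : ∀ s, (∑ l, Real.exp (δ l * (tstar + s)) • T l).det = expSum aQ' x s := by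
    intro s; have := congrFun hQfun (tstar + s); rw [this, expSum_add]
  -- parameters
  have ha : a ≠ 0 := by intro h; rw [h, zero_mul] at haκ; exact lt_irrefl _ haκ
  have hb : b ≠ 0 := by intro h; rw [h, mul_zero] at hab; exact lt_irrefl _ hab
  set lam : ℝ := -(2 * a) / b with hlam
  have hlam0 : 0 < lam := by
    have : lam = (-(2 * (a * b))) / b ^ 2 := by rw [hlam]; field_simp
    rw [this]
    exact div_pos (by linarith) (by positivity)
  have hflip : a * (a + lam * b) < 0 := by
    have : a + lam * b = -a := by rw [hlam]; field_simp; ring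
    rw [this]
    have : 0 < a ^ 2 := by positivity
    nlinarith
  have hMF : MF ≤ M := by rw [hM]; linarith
  have hMG : MG ≤ M := by rw [hM]; linarith
  have hMH : MH ≤ M := by rw [hM]; linarith
  refine mem_twentyLocus_of_tripleZero δ S T hS hT τ hτ κ hκ halt jstar tstar a b M 1 lam ht1 ht2 one_pos (by linarith)
    hlam0 haκ hflip ?_ ?_ ?_
  · intro s hs
    rw [eF]
    exact (cF s hs).trans (mul_le_mul_of_nonneg_right hMF (by positivity))
  · intro s hs
    rw [eG]
    exact (cG s hs).trans (mul_le_mul_of_nonneg_right hMG (by positivity))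
  · intro s hs
    rw [eH]
    exact (abs_expSum_le aQ' x hs).trans hMH

end Summit.ValiantsHypothesis.ValiantsHypothesis.Theorems.LacunarySymmetroidMatrixDescartes.WallBubbling
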